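import Literature.NumberTheory.DiophantineApproximation.PolylogHermitePadeExpansion
import HarnessLib

/-!
# Every-weight Hermite–Padé forms: integrality and size of the coefficients

Topic `Literature/NumberTheory/DiophantineApproximation`. For partial-fraction data `c` of the
weight-`w` kernel (`PolylogPade.exists_pf_kernelW`: `d_n^{w−1−o} c_{o,p} ∈ ℤ`,
`∑|c_{o,p}| ≤ w!·∏_{s<w} 2^n C(n(s+2), n)`), the coefficients of the form
`S^{(w)}_n(1/N) = ∑_{o<w} a_o Li_{o+1}(1/N) + a` (`PolylogPade.coefW`, `PolylogPade.constW`)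
become integers after multiplication by `d_n^w` (`isInt_lcmUpto_pow_mul_coefW`,
`isInt_lcmUpto_pow_mul_constW`; `d_n = lcm(1..n) = Nat.lcmUpto n`), and
`|a_o| ≤ (∑|c|)·N^n` (`abs_coefW_le`). Elementary bookkeeping for the linear independence of
`1, Li₁(1/N), …, Li_w(1/N)` (`PolylogLinearIndependence.lean`).

References: E. M. Nikišin, Mat. Sb. 109 (1979); T. Rivoal, C. R. Acad. Sci. Paris 331 (2000),
§2 Lemme 5 (the integrality mechanism); S. David, N. Hirata-Kohno, M. Kawashima (2020), Thm 2.1.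
-/

noncomputable section

open Finset

namespace Literature.NumberTheory.DiophantineApproximation

namespace PolylogPade

open Literature.NumberTheory.Transcendental

/-- **Integrality of the `Li`-coefficients**: `d_n^w · a_o ∈ ℤ` for `o < w`, from
`d_n^{w−1−o} c_{o,p} ∈ ℤ`. [cite: Rivoal2000, §2 Lemme 5] -/
theorem isInt_lcmUpto_pow_mul_coefW {w n : ℕ} {c : ℕ → ℕ → ℚ}
    (hc : BallRivoal.IsInt w (Nat.lcmUpto n) c) (N : ℕ) {o : ℕ} (ho : o < w) :
    ∃ z : ℤ, ((Nat.lcmUpto n : ℚ) ^ w) * coefW n c N o = z := by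
  classical
  -- each summand is an integer
  have hterm : ∀ p ∈ range (n + 1),
      ∃ z : ℤ, ((Nat.lcmUpto n : ℚ) ^ w) * (c o p * (N : ℚ) ^ p) = z := by
    intro p _
    obtain ⟨z, hz⟩ := hc o p
    refine ⟨z * (Nat.lcmUpto n : ℤ) ^ (o + 1) * (N : ℤ) ^ p, ?_⟩
    have hw : w = (w - 1 - o) + (o + 1) := by omega
    rw [hw, pow_add]
    push_cast
    rw [← hz]
    ring
  choose! z hz using hterm
  refine ⟨∑ p ∈ range (n + 1), z p, ?_⟩
  rw [coefW, mul_sum, Int.cast_sum]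
  exact sum_congr rfl fun p hp => hz p hp

/-- **Integrality of the constant term**: `d_n^w · a ∈ ℤ`, from `d_n^{w−1−o} c_{o,p} ∈ ℤ` and
`m^{o+1} ∣ d_n^{o+1}` for `1 ≤ m ≤ p ≤ n` (`N ≥ 1`). [cite: Rivoal2000, §2 Lemme 5] -/
theorem isInt_lcmUpto_pow_mul_constW {w n : ℕ} {c : ℕ → ℕ → ℚ}
    (hc : BallRivoal.IsInt w (Nat.lcmUpto n) c) {N : ℕ} (hN : 1 ≤ N) :
    ∃ z : ℤ, ((Nat.lcmUpto n : ℚ) ^ w) * constW n w c N = z := by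
  classical
  have hN0 : (N : ℚ) ≠ 0 := by exact_mod_cast (show N ≠ 0 by omega)
  -- each elementary summand `c_{o,p} N^p/(N^m m^{o+1})` becomes an integer
  have hterm : ∀ o ∈ range w, ∀ p ∈ range (n + 1), ∀ m ∈ Icc 1 p,
      ∃ z : ℤ, ((Nat.lcmUpto n : ℚ) ^ w) *
        (c o p * ((N : ℚ) ^ p / ((N : ℚ) ^ m * (m : ℚ) ^ (o + 1)))) = z := by
    intro o ho p hp m hm
    rw [mem_range] at ho hp
    rw [mem_Icc] at hm
    obtain ⟨z, hz⟩ := hc o p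
    obtain ⟨e, he⟩ : m ∣ Nat.lcmUpto n :=
      Int.natCast_dvd_natCast.1 (DilogPade.natCast_dvd_lcmUpto hm.1 (by omega : m ≤ n))
    have hm0 : (m : ℚ) ≠ 0 := by exact_mod_cast (show m ≠ 0 by omega)
    refine ⟨z * (e : ℤ) ^ (o + 1) * (N : ℤ) ^ (p - m), ?_⟩
    have hw : w = (w - 1 - o) + (o + 1) := by omega
    have hpm : p = (p - m) + m := by omega
    have hd : (Nat.lcmUpto n : ℚ) = (m : ℚ) * e := by exact_mod_cast he
    have hd' : (Nat.lcmUpto n : ℚ) ^ (o + 1) = (m : ℚ) ^ (o + 1) * (e : ℚ) ^ (o + 1) := by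
      rw [hd, mul_pow]
    have hNp : (N : ℚ) ^ p = (N : ℚ) ^ (p - m) * (N : ℚ) ^ m := by
      rw [← pow_add, ← hpm]
    rw [hw, pow_add, hd', hNp]
    push_cast
    rw [← hz]
    field_simp
  -- sum them up
  have hsum : ∃ z : ℤ, ((Nat.lcmUpto n : ℚ) ^ w) *
      (∑ o ∈ range w, ∑ p ∈ range (n + 1),
        c o p * ∑ m ∈ Icc 1 p, (N : ℚ) ^ p / ((N : ℚ) ^ m * (m : ℚ) ^ (o + 1))) = z := by
    have h1 : ∀ o ∈ range w, ∀ p ∈ range (n + 1), ∃ z : ℤ, ((Nat.lcmUpto n : ℚ) ^ w) *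
        (c o p * ∑ m ∈ Icc 1 p, (N : ℚ) ^ p / ((N : ℚ) ^ m * (m : ℚ) ^ (o + 1))) = z := by
      intro o ho p hp
      choose! z hz using hterm o ho p hp
      refine ⟨∑ m ∈ Icc 1 p, z m, ?_⟩
      rw [mul_sum, mul_sum, Int.cast_sum]
      exact sum_congr rfl fun m hm => hz m hm
    have h2 : ∀ o ∈ range w, ∃ z : ℤ, ((Nat.lcmUpto n : ℚ) ^ w) *
        (∑ p ∈ range (n + 1), c o p *
          ∑ m ∈ Icc 1 p, (N : ℚ) ^ p / ((N : ℚ) ^ m * (m : ℚ) ^ (o + 1))) = z := by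
      intro o ho
      choose! z hz using h1 o ho
      refine ⟨∑ p ∈ range (n + 1), z p, ?_⟩
      rw [mul_sum, Int.cast_sum]
      exact sum_congr rfl fun p hp => hz p hp
    choose! z hz using h2
    refine ⟨∑ o ∈ range w, z o, ?_⟩
    rw [mul_sum, Int.cast_sum]
    exact sum_congr rfl fun o ho => hz o ho
  obtain ⟨z, hz⟩ := hsum
  refine ⟨-z, ?_⟩
  rw [constW, mul_neg, hz, Int.cast_neg]

/-- **Size of the `Li`-coefficients**: `|a_o| ≤ (∑_{o,p} |c_{o,p}|) · N^n` for `N ≥ 1`, `o < w`.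
[folklore] -/
theorem abs_coefW_le {w n : ℕ} (c : ℕ → ℕ → ℚ) {N : ℕ} (hN : 1 ≤ N) {o : ℕ} (ho : o < w) :
    |coefW n c N o| ≤ BallRivoal.l1 n w c * (N : ℚ) ^ n := by
  have hN' : (1 : ℚ) ≤ N := by exact_mod_cast hN
  calc |coefW n c N o| ≤ ∑ p ∈ range (n + 1), |c o p * (N : ℚ) ^ p| := abs_sum_le_sum_abs _ _
    _ ≤ ∑ p ∈ range (n + 1), |c o p| * (N : ℚ) ^ n := by
        refine sum_le_sum fun p hp => ?_
        rw [abs_mul, abs_of_nonneg (by positivity : (0 : ℚ) ≤ (N : ℚ) ^ p)]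
        exact mul_le_mul_of_nonneg_left
          (pow_le_pow_right₀ hN' (Nat.lt_succ_iff.1 (mem_range.1 hp))) (abs_nonneg _)
    _ = (∑ p ∈ range (n + 1), |c o p|) * (N : ℚ) ^ n := by rw [sum_mul]
    _ ≤ BallRivoal.l1 n w c * (N : ℚ) ^ n := by
        refine mul_le_mul_of_nonneg_right ?_ (by positivity)
        rw [BallRivoal.l1]
        calc ∑ p ∈ range (n + 1), |c o p|
            = ∑ p ∈ range (n + 1), ∑ o' ∈ ({o} : Finset ℕ), |c o' p| := by simp
          _ ≤ ∑ p ∈ range (n + 1), ∑ o' ∈ range w, |c o' p| :=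
              sum_le_sum fun p _ => sum_le_sum_of_subset_of_nonneg
                (by simpa using ho) fun _ _ _ => abs_nonneg _

/-- The crude binomial bound on the factors of the `ℓ¹`-estimate of the kernel's
partial-fraction data: `2^n C(n(s+2), n) ≤ 2^{n(s+3)}` termwise (`C(m, n) ≤ 2^m`). [folklore] -/
theorem prod_two_pow_mul_choose_le (w n : ℕ) :
    ∏ s ∈ range w, ((2 : ℚ) ^ n * ((n * (s + 2)).choose n : ℚ)) ≤
      ∏ s ∈ range w, (2 : ℚ) ^ (n * (s + 3)) := by
  refine prod_le_prod (fun s _ => by positivity) fun s _ => ?_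
  have h : ((n * (s + 2)).choose n : ℚ) ≤ (2 : ℚ) ^ (n * (s + 2)) := by
    exact_mod_cast Nat.choose_le_two_pow (n * (s + 2)) n
  calc (2 : ℚ) ^ n * ((n * (s + 2)).choose n : ℚ) ≤ (2 : ℚ) ^ n * (2 : ℚ) ^ (n * (s + 2)) :=
        mul_le_mul_of_nonneg_left h (by positivity)
    _ = (2 : ℚ) ^ (n * (s + 3)) := by rw [← pow_add]; ring_nf

end PolylogPade

end Literature.NumberTheory.DiophantineApproximation
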